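import Mathlib
import Summits.QuantumFields.YangMills.Theorems.BalabanUVNodesN15BackgroundLayerFirstOrderMatrix
import Summits.QuantumFields.YangMills.Theorems.BalabanUVNodesN15BasisDictionary
import HarnessLib

/-!
# Route «BalabanUVNodes» (cluster K4 «SpineRates»), Track-A DAG node N15 = spine estimate NE2, BACKGROUND LAYER — «U LIVE» THROUGH THE PRINT's MATRIX
# SPECIES (non-abelian): an `𝔄`-valued GAUGE-FIELD carrier `A′` with the (3.35) letter pair in OPERATOR NORM, the first-order perturbation's MATRIX
# coefficients DERIVED from it by `Phi1(η, ad_A) = η⁻¹(exp(η ad_A) − 1)` in coordinates, and their max-row-sum letters under the guard — the input of M1's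
# non-abelian first-order pair space

Cell `pub-ymgap`, seat `pub-ymgap-dag-n15-c` (generation g2; R134 ACCELERATION SEAT, strategy s1 — g0's located successor object (N1′) «C1∕C2-MATRIX SPECIES»;
HUMAN RULING D-0062; chair R424 venue).  `bears_on: R4∕N15`.  Filed `--supports stmt-QuantumFields-19676` (K3; helper).  Imports BY NAME, nothing in the tree
modified: this seat's M2 `…N15BackgroundLayerFirstOrderMatrix` (through it M1 `unstackM`, `hasMaj_unstackM`, `hasMaj_idef_unstackM`, n15-b's B1b∕A1∕A2 `blkPair`,
`liftPair`, `fineGeo`, `abs_le_iSup_abs`, g0's `opGeo`) and n15-b's part 16 `…N15BasisDictionary` (`coordMat`, `basisConst`, `row_abs_sum_coordMat_le`,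
`rowFit_of_opNormFit`; through it parts 13a–c: `adCLM` letters, `Phi1`, `Phi1_lipschitz`, `lipschitz_comp_adCLM`, `fit_Phi1_ad`, `blockAvgV`, `fit_blockAvgV`,
`norm_blockAvgV_le`).

THE POINT.  n15-b's C1 `…N15BackgroundGaugeSpecies` derived the first-order coefficients from an ABELIAN scalar gauge field (`R = e^{ηA}` real).  The print
([Balaban1985BackgroundPropagators] (3.50)–(3.52) p. 400) has the covariant derivative `(D^η_Uλ)(b) = η⁻¹(R(U_b)λ(b₊) − λ(b₋))`, `R(U_b) = exp(iη ad_{A(b)})` acting on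
`𝔤`-valued fields, i.e. `D_U = M_R∘∇^η + M_{η⁻¹(R − 1)}` (n15-b part 18 `covD`), so `V = D_U − ∇^η = Σ_μ [M_{η·Phi1(η, ad A_μ)}∘∇_μ + M_{Phi1(η, ad A_μ)}]` has MATRIX
coefficients — in coordinates `e : 𝔄 ≃L[ℝ] ℝ^ι` (part 16): `A_μ^coef = η·coordMat e (Phi1(η, ad A_μ))`, `C = Σ_μ coordMat e (Phi1(η, ad A_μ))`.  THIS FILE is C1 for
the matrix species: the carrier `gaugeBgM` (`Cfg := A′ : J → X′ → 𝔄`, `Reg335 c α₀ A′ :=` sup letter `‖A′_μ(x′)‖ ≤ c·M·α₀` and fibrewise oscillation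
`‖A′_μ(x₁′) − A′_μ(x₂′)‖ ≤ c·M·α₀·θ`), the DERIVED matrix coefficients `gcoefM`∕`gacoefM` at both spacings (coarse field = `blockAvgV` of `A′`: the transport acts on
the GAUGE FIELD, the coefficients are NONLINEAR images), and `gaugeM_letters_of_reg335`: under the guard (`M ≥ 1`, `M·α₀ ≤ a₀`, `2c₃₅a₀ ≤ 1` so `2r ≤ 1` — the
`ad` regime of 13b) and `η′ ≤ η ≤ min(1, θ)`, the unstacked matrix perturbations have majorant `diagK (r₁(1+|J|))` and diagonal η-defect `diagK (r₁θ(1+|J|))` with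
the ONE letter `r₁ = 8e(1+|J|)κ_e·c₃₅Mα₀` (`κ_e = basisConst e`) — exactly M1's perturbation letters.  The sequel (`…BackgroundGaugeMatrixByName`) reads the four
(3.42) entries out by name.

CONTENTS ([folklore]; 5 defs).
* §1 `norm_Phi1_adCLM_le` (`‖Phi1(s, ad Z)‖ ≤ 2e·r` on `‖Z‖ ≤ r`, `2r ≤ 1`, `0 ≤ s ≤ 1`), `gcoefM`∕`gacoefM` (the derived matrix coefficients), row letters
  `rowSum_coordMat_Phi1_le`, `rowSum_gcoefM_le`, `rowSum_gacoefM_le`, row fits `rowFit_coordMat_Phi1`, `rowFit_gcoefM`, `rowFit_gacoefM` (`fit_Phi1_ad` +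
  `rowFit_of_opNormFit`; the `a`-fit pays `(η − η′)·κ_e·2e·r` for the spacing inside `R − 1`).
* §2 `gaugeBgM 𝔄 J π M θ : B9.Backgrounds`, `reg335_gaugeBgM_iff`, `gavgM`∕`gavgM_zero`, `gaugePairingM`, `gaugeInstanceM`, `gaugeInstanceM_M`.
* §3 **`gaugeM_letters_of_reg335`** — M1's perturbation letters (`hasMaj_unstackM` twice, `hasMaj_idef_unstackM`) DISCHARGED from the gauge field's (3.35).

HONEST FRAMING ∕ LIMITS.  `𝔤` MODELLED by a complete real normed algebra `𝔄 ≅ ℝ^ι` with `ad` = the commutator (parts 13a–c) and a coordinate system `e`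
(constant `κ_e`); one `Phi1` per direction (the second-order `F′_{1,k}`∕`Phi2` coefficient is 13b's, not wired); linearised transport of the gauge field
(`blockAvgV`), crude constants; the `U ≡ 1` layer DISPLAYED downstream; nothing of Bałaban's `G(U)` asserted.  NE2⁺ NOT PRINTED, NOT proved; count-neutral
(typed 28∕28; nothing discharged); N15 NOT discharged; one finite lattice at fixed ε — NOT infinite volume, NOT OS on ℝ⁴, NOT a mass gap, NOT Clay.
-/

noncomputable section

open scoped BigOperators

namespace Summit.QuantumFields.YangMills.BalabanUVNodes.N15.BackgroundLayer

open Literature.MathematicalPhysics.QuantumFieldTheory.Balaban1983to89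
open Literature.MathematicalPhysics.QuantumFieldTheory.Balaban1983to89.B11SectG (BlockNorm HasMaj)
open Literature.MathematicalPhysics.QuantumFieldTheory.Balaban1983to89.T4EtaRate (PairedInstance EtaPairing)
open Literature.MathematicalPhysics.QuantumFieldTheory.Balaban1983to89.T4EtaRateDefect (idef)
open Literature.MathematicalPhysics.QuantumFieldTheory.Balaban1983to89.T4EtaRateCoeffDefect (pull diagK)
open Literature.MathematicalPhysics.QuantumFieldTheory.Balaban1983to89.Beta.AveragingCorrectionJets (adCLM adCLM_zero)
open Summit.QuantumFields.YangMills.BalabanUVNodes.N15.OperatorReadout (opGeo)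
open Summit.QuantumFields.YangMills.BalabanUVNodes.N15.MatrixSpecies (liftMap liftBlk Phi1 Phi1_zero Phi1_lipschitz Phi1_consistency lipschitz_comp_adCLM
  fit_Phi1_ad coordMat
  basisConst basisConst_nonneg row_abs_sum_coordMat_le rowFit_of_opNormFit blockAvgV fit_blockAvgV norm_blockAvgV_le)

/-! ## §1 The matrix species as derived first-order coefficients in coordinates, and their row letters -/

section Species

variable {X X' J ι : Type} [Fintype J] [Fintype ι] [DecidableEq ι] {𝔄 : Type} [NormedRing 𝔄] [NormedAlgebra ℝ 𝔄] [CompleteSpace 𝔄]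
  (e : 𝔄 ≃L[ℝ] (ι → ℝ))

/-- SIZE OF THE MATRIX SPECIES: `‖Phi1(s, ad Z)‖ ≤ 2e·r` for `‖Z‖ ≤ r` in the `ad` regime `2r ≤ 1`, `0 ≤ s ≤ 1` (13b's `lipschitz_comp_adCLM` against `Z₂ = 0`;
`Phi1(s, 0) = 0` by `Phi1_consistency` at `r = 0`). [folklore] -/
theorem norm_Phi1_adCLM_le {r s : ℝ} (hr2 : 2 * r ≤ 1) (hs0 : 0 ≤ s) (hs : s ≤ 1) {Z : 𝔄} (hZ : ‖Z‖ ≤ r) :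
    ‖Phi1 s (adCLM ℝ Z)‖ ≤ 2 * Real.exp 1 * r := by
  have hreg : (1 : ℝ) * (2 * r) ≤ 1 := by rw [one_mul]; exact hr2
  have hr : 0 ≤ r := (norm_nonneg Z).trans hZ
  have h := lipschitz_comp_adCLM (𝔄 := 𝔄) Phi1 (Real.exp_pos 1).le (Phi1_lipschitz hreg) s hs0 hs Z 0 hZ (by simpa using hr)
  have h0 : Phi1 s (0 : 𝔄 →L[ℝ] 𝔄) = 0 := by
    have hc := Phi1_consistency (𝔸 := 𝔄 →L[ℝ] 𝔄) (η₀ := 1) (r := 0) (by norm_num) s hs0 hs 0 (by simp)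
    rw [Phi1_zero, sub_zero] at hc
    have : ‖Phi1 s (0 : 𝔄 →L[ℝ] 𝔄)‖ ≤ 0 := hc.trans (by simp)
    exact norm_le_zero_iff.1 this
  rw [adCLM_zero, h0, sub_zero, sub_zero] at h
  exact h.trans (mul_le_mul_of_nonneg_left hZ (by positivity))

/-- THE DERIVED ZEROTH-ORDER MATRIX COEFFICIENT `C = Σ_μ coordMat e (Phi1(η, ad A_μ))` (the `M_{η⁻¹(R − 1)}` terms of `D_U − ∇`, `R = exp(η ad_A)`, in coordinates).
[cite: Balaban1985BackgroundPropagators, (3.50) p.400 (covariant derivative with `exp(iη ad_{A(b)})`: shape)] -/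
def gcoefM (η : ℝ) (A : J → X → 𝔄) : X → Matrix ι ι ℝ := fun x => ∑ μ, coordMat e (Phi1 η (adCLM ℝ (A μ x)))

/-- THE DERIVED FIRST-ORDER MATRIX COEFFICIENTS `A_μ^coef = η·coordMat e (Phi1(η, ad A_μ)) = R_μ − 1` (the `M_{R − 1}∘∇_μ` terms, in coordinates).
[cite: Balaban1985BackgroundPropagators, (3.50) p.400 (shape)] -/
def gacoefM (η : ℝ) (A : J → X → 𝔄) : J → X → Matrix ι ι ℝ := fun μ x => η • coordMat e (Phi1 η (adCLM ℝ (A μ x)))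

omit [Fintype J] in
/-- ROW LETTER of ONE coordinate matrix `coordMat e (Phi1(s, ad Z))`: `≤ κ_e·2e·r`. [folklore] -/
theorem rowSum_coordMat_Phi1_le {r s : ℝ} (hr2 : 2 * r ≤ 1) (hs0 : 0 ≤ s) (hs : s ≤ 1) {Z : 𝔄} (hZ : ‖Z‖ ≤ r) (i : ι) :
    ∑ j, |coordMat e (Phi1 s (adCLM ℝ Z)) i j| ≤ basisConst e * (2 * Real.exp 1 * r) :=
  (row_abs_sum_coordMat_le e _ i).trans (mul_le_mul_of_nonneg_left (norm_Phi1_adCLM_le hr2 hs0 hs hZ) (basisConst_nonneg e))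

/-- SUP ROW LETTER of `C`: `Σ_j |C(x)_{ij}| ≤ |J|·κ_e·2e·r`. [folklore] -/
theorem rowSum_gcoefM_le {r η : ℝ} (hr2 : 2 * r ≤ 1) (hη0 : 0 ≤ η) (hη1 : η ≤ 1) {A : J → X → 𝔄} (hA : ∀ μ x, ‖A μ x‖ ≤ r) (x : X) (i : ι) :
    ∑ j, |gcoefM e η A x i j| ≤ Fintype.card J * (basisConst e * (2 * Real.exp 1 * r)) := by
  unfold gcoefM
  calc ∑ j, |(∑ μ, coordMat e (Phi1 η (adCLM ℝ (A μ x)))) i j|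
      = ∑ j, |∑ μ, coordMat e (Phi1 η (adCLM ℝ (A μ x))) i j| := by simp only [Matrix.sum_apply]
    _ ≤ ∑ j, ∑ μ, |coordMat e (Phi1 η (adCLM ℝ (A μ x))) i j| := Finset.sum_le_sum fun j _ => Finset.abs_sum_le_sum_abs _ _
    _ = ∑ μ, ∑ j, |coordMat e (Phi1 η (adCLM ℝ (A μ x))) i j| := Finset.sum_comm
    _ ≤ ∑ _μ : J, basisConst e * (2 * Real.exp 1 * r) := Finset.sum_le_sum fun μ _ => rowSum_coordMat_Phi1_le e hr2 hη0 hη1 (hA μ x) i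
    _ = Fintype.card J * (basisConst e * (2 * Real.exp 1 * r)) := by rw [Finset.sum_const, Finset.card_univ, nsmul_eq_mul]

omit [Fintype J] in
/-- SUP ROW LETTER of `A_μ^coef`: `Σ_j |A_μ^coef(x)_{ij}| ≤ η·κ_e·2e·r ≤ κ_e·2e·r` for `η ≤ 1`. [folklore] -/
theorem rowSum_gacoefM_le {r η : ℝ} (hr2 : 2 * r ≤ 1) (hη0 : 0 ≤ η) (hη1 : η ≤ 1) {A : J → X → 𝔄} (hA : ∀ μ x, ‖A μ x‖ ≤ r) (μ : J) (x : X)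
    (i : ι) : ∑ j, |gacoefM e η A μ x i j| ≤ basisConst e * (2 * Real.exp 1 * r) := by
  unfold gacoefM
  have h1 := rowSum_coordMat_Phi1_le e hr2 hη0 hη1 (hA μ x) i
  calc ∑ j, |(η • coordMat e (Phi1 η (adCLM ℝ (A μ x)))) i j| = η * ∑ j, |coordMat e (Phi1 η (adCLM ℝ (A μ x))) i j| := by
        rw [Finset.mul_sum]
        refine Finset.sum_congr rfl fun j _ => ?_
        rw [Matrix.smul_apply, smul_eq_mul, abs_mul, abs_of_nonneg hη0]
    _ ≤ 1 * (basisConst e * (2 * Real.exp 1 * r)) := mul_le_mul hη1 h1 (Finset.sum_nonneg fun j _ => abs_nonneg _) zero_le_one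
    _ = basisConst e * (2 * Real.exp 1 * r) := one_mul _

omit [Fintype J] in
/-- ROW FIT of ONE coordinate matrix: with the gauge-field fit `‖A′_μ − Ā_μ∘π‖ ≤ rθ`, sizes `≤ r`, `2r ≤ 1`, spacings `0 ≤ η′ ≤ η ≤ 1`, `η ≤ θ`:
`Σ_j |coordMat e (Phi1(η′, ad A′_μ(x′)))_{ij} − coordMat e (Phi1(η, ad Ā_μ(πx′)))_{ij}| ≤ κ_e·6e·rθ` (13b `fit_Phi1_ad`: `2e·rθ + 8e·r²η`, and `r²η ≤ rθ∕2`).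
[folklore] -/
theorem rowFit_coordMat_Phi1 (π : X' → X) {r η η' θ : ℝ} (hr : 0 ≤ r) (hr2 : 2 * r ≤ 1) (hη' : 0 ≤ η') (hη'η : η' ≤ η) (hη1 : η ≤ 1) (hηθ : η ≤ θ)
    {A' : J → X' → 𝔄} {A : J → X → 𝔄} (hA' : ∀ μ x', ‖A' μ x'‖ ≤ r) (hA : ∀ μ x, ‖A μ x‖ ≤ r) (hfit : ∀ μ x', ‖A' μ x' - A μ (π x')‖ ≤ r * θ)
    (μ : J) (x' : X') (i : ι) :
    ∑ j, |coordMat e (Phi1 η' (adCLM ℝ (A' μ x'))) i j - coordMat e (Phi1 η (adCLM ℝ (A μ (π x')))) i j| ≤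
      basisConst e * (6 * Real.exp 1 * (r * θ)) := by
  have hreg : (1 : ℝ) * (2 * r) ≤ 1 := by rw [one_mul]; exact hr2
  have hfit1 : ∀ x', ‖Phi1 η' (adCLM ℝ (A' μ x')) - Phi1 η (adCLM ℝ (A μ (π x')))‖ ≤
      (2 * Real.exp 1) * (r * θ) + 2 * (Real.exp 1 * (2 * r) ^ 2) * η :=
    fun x' => fit_Phi1_ad π hreg hη' hη'η hη1 (hA' μ) (hA μ) (o := fun _ => r * θ) (fun x' => hfit μ x') x'
  have h := rowFit_of_opNormFit e π (C' := fun x' => Phi1 η' (adCLM ℝ (A' μ x'))) (C := fun x => Phi1 η (adCLM ℝ (A μ x)))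
    (o := fun _ => (2 * Real.exp 1) * (r * θ) + 2 * (Real.exp 1 * (2 * r) ^ 2) * η) hfit1 x' i
  refine h.trans (mul_le_mul_of_nonneg_left ?_ (basisConst_nonneg e))
  have hη0 : 0 ≤ η := hη'.trans hη'η
  have hrη : r * η ≤ 1 / 2 * θ := mul_le_mul (by linarith) hηθ hη0 (by norm_num)
  have h1 : r ^ 2 * η ≤ r * θ / 2 := by
    calc r ^ 2 * η = r * (r * η) := by ring
      _ ≤ r * (1 / 2 * θ) := mul_le_mul_of_nonneg_left hrη hr
      _ = r * θ / 2 := by ring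
  calc (2 * Real.exp 1) * (r * θ) + 2 * (Real.exp 1 * (2 * r) ^ 2) * η
      = 2 * Real.exp 1 * (r * θ) + 8 * Real.exp 1 * (r ^ 2 * η) := by ring
    _ ≤ 2 * Real.exp 1 * (r * θ) + 8 * Real.exp 1 * (r * θ / 2) := by gcongr
    _ = 6 * Real.exp 1 * (r * θ) := by ring

/-- ROW FIT of `C`: `Σ_j |C′(x′)_{ij} − C̄(πx′)_{ij}| ≤ |J|·κ_e·6e·rθ`. [folklore] -/
theorem rowFit_gcoefM (π : X' → X) {r η η' θ : ℝ} (hr : 0 ≤ r) (hr2 : 2 * r ≤ 1) (hη' : 0 ≤ η') (hη'η : η' ≤ η) (hη1 : η ≤ 1) (hηθ : η ≤ θ)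
    {A' : J → X' → 𝔄} {A : J → X → 𝔄} (hA' : ∀ μ x', ‖A' μ x'‖ ≤ r) (hA : ∀ μ x, ‖A μ x‖ ≤ r) (hfit : ∀ μ x', ‖A' μ x' - A μ (π x')‖ ≤ r * θ)
    (x' : X') (i : ι) :
    ∑ j, |gcoefM e η' A' x' i j - gcoefM e η A (π x') i j| ≤ Fintype.card J * (basisConst e * (6 * Real.exp 1 * (r * θ))) := by
  unfold gcoefM
  calc ∑ j, |(∑ μ, coordMat e (Phi1 η' (adCLM ℝ (A' μ x')))) i j - (∑ μ, coordMat e (Phi1 η (adCLM ℝ (A μ (π x'))))) i j|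
      = ∑ j, |∑ μ, (coordMat e (Phi1 η' (adCLM ℝ (A' μ x'))) i j - coordMat e (Phi1 η (adCLM ℝ (A μ (π x')))) i j)| := by
        simp only [Matrix.sum_apply, Finset.sum_sub_distrib]
    _ ≤ ∑ j, ∑ μ, |coordMat e (Phi1 η' (adCLM ℝ (A' μ x'))) i j - coordMat e (Phi1 η (adCLM ℝ (A μ (π x')))) i j| :=
        Finset.sum_le_sum fun j _ => Finset.abs_sum_le_sum_abs _ _
    _ = ∑ μ, ∑ j, |coordMat e (Phi1 η' (adCLM ℝ (A' μ x'))) i j - coordMat e (Phi1 η (adCLM ℝ (A μ (π x')))) i j| := Finset.sum_comm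
    _ ≤ ∑ _μ : J, basisConst e * (6 * Real.exp 1 * (r * θ)) :=
        Finset.sum_le_sum fun μ _ => rowFit_coordMat_Phi1 e π hr hr2 hη' hη'η hη1 hηθ hA' hA hfit μ x' i
    _ = Fintype.card J * (basisConst e * (6 * Real.exp 1 * (r * θ))) := by rw [Finset.sum_const, Finset.card_univ, nsmul_eq_mul]

omit [Fintype J] in
/-- ROW FIT of `A_μ^coef`: `Σ_j |A′coef_μ(x′)_{ij} − Ācoef_μ(πx′)_{ij}| ≤ η′·κ_e·6e·rθ + (η − η′)·κ_e·2e·r ≤ κ_e·8e·rθ` — the species fit plus the spacing inside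
`R − 1 = η·Phi1`. [folklore] -/
theorem rowFit_gacoefM (π : X' → X) {r η η' θ : ℝ} (hr : 0 ≤ r) (hr2 : 2 * r ≤ 1) (hη' : 0 ≤ η') (hη'η : η' ≤ η) (hη1 : η ≤ 1) (hηθ : η ≤ θ)
    {A' : J → X' → 𝔄} {A : J → X → 𝔄} (hA' : ∀ μ x', ‖A' μ x'‖ ≤ r) (hA : ∀ μ x, ‖A μ x‖ ≤ r) (hfit : ∀ μ x', ‖A' μ x' - A μ (π x')‖ ≤ r * θ)
    (μ : J) (x' : X') (i : ι) :
    ∑ j, |gacoefM e η' A' μ x' i j - gacoefM e η A μ (π x') i j| ≤ basisConst e * (8 * Real.exp 1 * (r * θ)) := by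
  unfold gacoefM
  set M' : Matrix ι ι ℝ := coordMat e (Phi1 η' (adCLM ℝ (A' μ x'))) with hM'
  set M : Matrix ι ι ℝ := coordMat e (Phi1 η (adCLM ℝ (A μ (π x')))) with hM
  have hη0 : 0 ≤ η := hη'.trans hη'η
  have hθ0 : 0 ≤ θ := hη0.trans hηθ
  have h1 : ∑ j, |M' i j - M i j| ≤ basisConst e * (6 * Real.exp 1 * (r * θ)) :=
    rowFit_coordMat_Phi1 e π hr hr2 hη' hη'η hη1 hηθ hA' hA hfit μ x' i
  have h2 : ∑ j, |M i j| ≤ basisConst e * (2 * Real.exp 1 * r) := rowSum_coordMat_Phi1_le e hr2 hη0 hη1 (hA μ (π x')) i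
  have hsplit : ∀ j, (η' • M') i j - (η • M) i j = η' * (M' i j - M i j) - (η - η') * M i j := fun j => by
    simp only [Matrix.smul_apply, smul_eq_mul]
    ring
  calc ∑ j, |(η' • M') i j - (η • M) i j| = ∑ j, |η' * (M' i j - M i j) - (η - η') * M i j| :=
        Finset.sum_congr rfl fun j _ => by rw [hsplit]
    _ ≤ ∑ j, (η' * |M' i j - M i j| + (η - η') * |M i j|) := Finset.sum_le_sum fun j _ => by
        refine (abs_sub _ _).trans (le_of_eq ?_)
        rw [abs_mul, abs_mul, abs_of_nonneg hη', abs_of_nonneg (by linarith : 0 ≤ η - η')]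
    _ = η' * ∑ j, |M' i j - M i j| + (η - η') * ∑ j, |M i j| := by
        rw [Finset.sum_add_distrib, Finset.mul_sum, Finset.mul_sum]
    _ ≤ 1 * (basisConst e * (6 * Real.exp 1 * (r * θ))) + θ * (basisConst e * (2 * Real.exp 1 * r)) :=
        add_le_add (mul_le_mul (hη'η.trans hη1) h1 (Finset.sum_nonneg fun _ _ => abs_nonneg _) zero_le_one)
          (mul_le_mul (by linarith) h2 (Finset.sum_nonneg fun _ _ => abs_nonneg _) hθ0)
    _ = basisConst e * (8 * Real.exp 1 * (r * θ)) := by ring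

end Species

/-! ## §2 The `𝔄`-valued gauge-field carrier, the pairing on the product carrier, the instances -/

section Carrier

variable {X X' : Type} (𝔄 J : Type) [NormedAddCommGroup 𝔄] [NormedSpace ℝ 𝔄]

/-- THE `𝔄`-VALUED GAUGE-FIELD BACKGROUND CARRIER (non-abelian): configurations are fine gauge fields `A′ : J → X′ → 𝔄` (one `𝔤`-valued component per direction;
`U′ = exp(η′A′)`), `one := 0`, `mul := (+)`, and `Reg335 c α₀ A′` = THE (3.35) LETTER PAIR on every component IN THE NORM OF `𝔄`: `‖A′_μ(x′)‖ ≤ c·M·α₀` and the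
fibrewise oscillation `‖A′_μ(x₁′) − A′_μ(x₂′)‖ ≤ c·M·α₀·θ` (`πx₁′ = πx₂′`); `Reg336` repeats it; (3.37)–(3.38) inert.
[cite: Balaban1985BackgroundPropagators, (3.35) p.396 («|A| < O(1)Mα₀(L^jη)^{−1}, |∇^ηA| < O(1)Mα₀(L^jη)^{−2} on □»: shape)] -/
def gaugeBgM (π : X' → X) (M θ : ℝ) : B9.Backgrounds where
  Cfg := J → X' → 𝔄
  one := 0
  mul := fun A₁ A₂ => A₁ + A₂
  Reg335 := fun c α₀ A' => (∀ μ x', ‖A' μ x'‖ ≤ c * M * α₀) ∧ ∀ μ x₁' x₂', π x₁' = π x₂' → ‖A' μ x₁' - A' μ x₂'‖ ≤ c * M * α₀ * θ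
  Reg336 := fun c α₀ A' => (∀ μ x', ‖A' μ x'‖ ≤ c * M * α₀) ∧ ∀ μ x₁' x₂', π x₁' = π x₂' → ‖A' μ x₁' - A' μ x₂'‖ ≤ c * M * α₀ * θ
  Cplx337 := fun _ _ _ => True
  Cplx338 := fun _ _ _ => True

omit [NormedSpace ℝ 𝔄] in
/-- Unfolding of the carrier's (3.35). [folklore] -/
theorem reg335_gaugeBgM_iff (π : X' → X) (M θ c α₀ : ℝ) (A' : J → X' → 𝔄) :
    (gaugeBgM 𝔄 J π M θ).Reg335 c α₀ A' ↔
      (∀ μ x', ‖A' μ x'‖ ≤ c * M * α₀) ∧ ∀ μ x₁' x₂', π x₁' = π x₂' → ‖A' μ x₁' - A' μ x₂'‖ ≤ c * M * α₀ * θ := Iff.rfl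

variable [Fintype X'] [DecidableEq X]

/-- THE TRANSPORT of the `𝔄`-valued gauge field: the fibrewise mean of every component (13c `blockAvgV`; linearised (C3)). [folklore] -/
def gavgM (π : X' → X) (A' : J → X' → 𝔄) : J → X → 𝔄 := fun μ => blockAvgV π (A' μ)

/-- `avg_one`. [folklore] -/
theorem gavgM_zero (π : X' → X) : gavgM 𝔄 J π (0 : J → X' → 𝔄) = 0 := by
  funext μ x
  simp [gavgM, blockAvgV]

variable {g : B6.Geometry} [Fintype X] (ι : Type) [Fintype ι]

/-- THE η-PAIRING over the `𝔄`-valued gauge-field carriers ON THE PRODUCT CARRIER `X × ι` (NOT PRINTED data): scale shift `n`, identity on sites, pull-back of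
`𝔤 ≅ ℝ^ι`-valued test functions along `liftMap π ι`, fibrewise-averaged gauge field. [cite: King1986, p.664 (convention before Prop. 3.8)] -/
def gaugePairingM (blk : X → g.Site) (π : X' → X) (n : ℕ) (hL : g.L ≠ 0) (θc θ : ℝ) :
    EtaPairing (opGeo g (X × ι) (liftBlk blk ι)) (fineGeo g (X' × ι) (liftBlk (blk ∘ π) ι) n) (gaugeBgM 𝔄 J (fun x : X => x) g.M θc)
      (gaugeBgM 𝔄 J π g.M θ) where
  n := n
  k_eq := rfl
  L_eq := rfl
  M_eq := rfl
  eta_eq := by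
    show g.eta * (g.L ^ n)⁻¹ * g.L ^ n = g.eta
    rw [mul_assoc, inv_mul_cancel₀ (pow_ne_zero _ hL), mul_one]
  ι := fun y => y
  scale_ι := fun _ => rfl
  dist_ι := fun _ _ => rfl
  τ := fun lam => pull (liftMap π ι) lam
  suppIn_τ := fun _ _ h p hp => h (liftMap π ι p) hp
  supNorm_τ := fun lam => by
    show (⨆ p : X' × ι, |lam (liftMap π ι p)|) ≤ ⨆ p : X × ι, |lam p|
    exact Real.iSup_le (fun p => abs_le_iSup_abs lam (liftMap π ι p)) (Real.iSup_nonneg fun p => abs_nonneg _)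
  avg := gavgM 𝔄 J π
  avg_one := gavgM_zero 𝔄 J π

/-- THE REALISED PAIRED INSTANCE over the `𝔄`-valued gauge-field carriers (test functions = `𝔤 ≅ ℝ^ι`-valued fields, blocked through `liftBlk`).
[cite: Balaban1985BackgroundPropagators, Thm 3.14 pp.426–427 (typing template)] -/
def gaugeInstanceM (blk : X → g.Site) (π : X' → X) (n : ℕ) (hL : g.L ≠ 0) (θc θ : ℝ) : PairedInstance :=
  ⟨opGeo g (X × ι) (liftBlk blk ι), fineGeo g (X' × ι) (liftBlk (blk ∘ π) ι) n, gaugeBgM 𝔄 J (fun x : X => x) g.M θc, gaugeBgM 𝔄 J π g.M θ,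
    gaugePairingM 𝔄 J ι blk π n hL θc θ⟩

/-- THE GUARD IS LIVE: the fine geometry's [B9] size parameter is the datum's `M`. [folklore] -/
theorem gaugeInstanceM_M (blk : X → g.Site) (π : X' → X) (n : ℕ) (hL : g.L ≠ 0) (θc θ : ℝ) :
    (gaugeInstanceM 𝔄 J ι blk π n hL θc θ).gf.M = g.M := rfl

end Carrier

/-! ## §3 The perturbation letters of the derived matrix coefficients, read off `Reg335` under the guard -/

section Letters

variable {X X' J ι : Type} [Fintype X] [Fintype X'] [Fintype J] [Fintype ι] [DecidableEq X] [DecidableEq ι] {𝔄 : Type} [NormedRing 𝔄]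
  [NormedAlgebra ℝ 𝔄] [CompleteSpace 𝔄] (e : 𝔄 ≃L[ℝ] (ι → ℝ)) {g : B6.Geometry} (blk : X → g.Site) (π : X' → X)

/-- **THE NON-ABELIAN PERTURBATION LETTERS FROM THE GAUGE FIELD's (3.35).**  Spacings `0 ≤ η′ ≤ η ≤ 1`, `η ≤ θ` (the rate number dominates the spacing); guard
`c₃₅ > 0`, `M ≥ 1`, `α₀ > 0`, `M·α₀ ≤ a₀`, `2c₃₅a₀ ≤ 1` (so `2r ≤ 1` for `r = c₃₅Mα₀`: the `ad` regime); `(gaugeBgM 𝔄 J π M θ).Reg335 c₃₅ α₀ A′`.  Then with the ONE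
letter `r₁ = 8e(1 + |J|)κ_e·r` (`κ_e = basisConst e`): the unstacked MATRIX perturbations of the DERIVED coefficients — fine `(gcoefM e η′ A′, gacoefM e η′ A′)`,
coarse `(gcoefM e η Ā, gacoefM e η Ā)`, `Ā = gavgM A′` — have majorants `diagK (r₁(1+|J|))` on the product carriers and the diagonal η-defect `diagK (r₁θ(1+|J|))`
through `(pull (liftPair (liftMap π ι)), pull (liftMap π ι))`; and `0 ≤ r₁ ≤ 8e(1+|J|)κ_e·c₃₅·a₀` — exactly M1's `hasMaj_idef_bgPairM` letters.
[cite: Balaban1985BackgroundPropagators, Thm 3.1 p.397 (quantifier template); (3.35) p.396, (3.50)–(3.52) p.400 (shapes)] -/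
theorem gaugeM_letters_of_reg335 {η η' θ c35 a₀ M α₀ : ℝ} (hη' : 0 ≤ η') (hη'η : η' ≤ η) (hη1 : η ≤ 1) (hηθ : η ≤ θ) (hc35 : 0 < c35)
    (hM : 1 ≤ M) (hα₀ : 0 < α₀) (hMα : M * α₀ ≤ a₀) (ha₀1 : 2 * (c35 * a₀) ≤ 1) {A' : J → X' → 𝔄}
    (hreg : (gaugeBgM 𝔄 J π M θ).Reg335 c35 α₀ A') :
    0 ≤ 8 * Real.exp 1 * (1 + Fintype.card J) * basisConst e * (c35 * M * α₀) ∧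
      8 * Real.exp 1 * (1 + Fintype.card J) * basisConst e * (c35 * M * α₀) ≤ 8 * Real.exp 1 * (1 + Fintype.card J) * basisConst e * c35 * a₀ ∧
      HasMaj (BlockNorm.ofBlocks g (blkPair (liftBlk blk ι))) (BlockNorm.ofBlocks g (liftBlk blk ι))
        (unstackM (gcoefM e η (gavgM 𝔄 J π A')) (gacoefM e η (gavgM 𝔄 J π A')))
        (diagK fun _ => 8 * Real.exp 1 * (1 + Fintype.card J) * basisConst e * (c35 * M * α₀) * (1 + Fintype.card J)) ∧
      HasMaj (BlockNorm.ofBlocks g (blkPair (liftBlk (blk ∘ π) ι))) (BlockNorm.ofBlocks g (liftBlk (blk ∘ π) ι))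
        (unstackM (gcoefM e η' A') (gacoefM e η' A'))
        (diagK fun _ => 8 * Real.exp 1 * (1 + Fintype.card J) * basisConst e * (c35 * M * α₀) * (1 + Fintype.card J)) ∧
      HasMaj (BlockNorm.ofBlocks g (blkPair (liftBlk blk ι))) (BlockNorm.ofBlocks g (liftBlk (blk ∘ π) ι))
        (idef (pull (liftPair (liftMap π ι))) (pull (liftMap π ι)) (unstackM (gcoefM e η' A') (gacoefM e η' A'))
          (unstackM (gcoefM e η (gavgM 𝔄 J π A')) (gacoefM e η (gavgM 𝔄 J π A'))))
        (diagK fun _ => 8 * Real.exp 1 * (1 + Fintype.card J) * basisConst e * (c35 * M * α₀) * θ * (1 + Fintype.card J)) := by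
  obtain ⟨hsup, hosc⟩ := (reg335_gaugeBgM_iff 𝔄 J π M θ c35 α₀ A').1 hreg
  set r : ℝ := c35 * M * α₀ with hr_def
  have hκ : 0 ≤ basisConst e := basisConst_nonneg e
  have he : 0 ≤ Real.exp 1 := Real.exp_nonneg 1
  have hJ0 : (0 : ℝ) ≤ 1 + Fintype.card J := by positivity
  have hJ1 : (Fintype.card J : ℝ) ≤ 1 + Fintype.card J := by linarith
  have hJ1' : (1 : ℝ) ≤ 1 + Fintype.card J := le_add_of_nonneg_right (Nat.cast_nonneg _)
  have hM0 : 0 ≤ M := zero_le_one.trans hM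
  have hr0 : 0 ≤ r := by positivity
  have hra : r ≤ c35 * a₀ := by rw [hr_def, mul_assoc]; exact mul_le_mul_of_nonneg_left hMα hc35.le
  have hr2 : 2 * r ≤ 1 := (mul_le_mul_of_nonneg_left hra zero_le_two).trans ha₀1
  have hη0 : 0 ≤ η := hη'.trans hη'η
  have hθ0 : 0 ≤ θ := hη0.trans hηθ
  -- coarse gauge field: fibrewise means stay in the box; fit from the oscillation letter
  have hAbar : ∀ μ x, ‖gavgM 𝔄 J π A' μ x‖ ≤ r := fun μ x => norm_blockAvgV_le π hr0 (hsup μ) x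
  have hfitA : ∀ μ x', ‖A' μ x' - gavgM 𝔄 J π A' μ (π x')‖ ≤ r * θ := fun μ x' =>
    fit_blockAvgV π (Ω := fun _ => r * θ) (fun x₁' x₂' h => hosc μ x₁' x₂' h) x'
  -- the one letter
  set r₁ : ℝ := 8 * Real.exp 1 * (1 + Fintype.card J) * basisConst e * r with hr₁_def
  have hr₁0 : 0 ≤ r₁ := by positivity
  have hunit : basisConst e * (2 * Real.exp 1 * r) ≤ 8 * Real.exp 1 * basisConst e * r := by nlinarith [mul_nonneg hκ (mul_nonneg he hr0)]
  have hone : 8 * Real.exp 1 * basisConst e * r ≤ r₁ := by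
    rw [hr₁_def]
    have h0 : 0 ≤ 8 * Real.exp 1 * basisConst e * r := by positivity
    calc 8 * Real.exp 1 * basisConst e * r = 1 * (8 * Real.exp 1 * basisConst e * r) := (one_mul _).symm
      _ ≤ (1 + Fintype.card J) * (8 * Real.exp 1 * basisConst e * r) := mul_le_mul_of_nonneg_right hJ1' h0
      _ = 8 * Real.exp 1 * (1 + Fintype.card J) * basisConst e * r := by ring
  have hJsmall : Fintype.card J * (basisConst e * (2 * Real.exp 1 * r)) ≤ r₁ := by
    calc Fintype.card J * (basisConst e * (2 * Real.exp 1 * r)) ≤ (1 + Fintype.card J) * (8 * Real.exp 1 * basisConst e * r) :=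
          mul_le_mul hJ1 hunit (by positivity) hJ0
      _ = r₁ := by rw [hr₁_def]; ring
  -- sup row letters (both spacings)
  have hc' : ∀ x' i, ∑ j, |gcoefM e η' A' x' i j| ≤ r₁ := fun x' i =>
    (rowSum_gcoefM_le e hr2 hη' (hη'η.trans hη1) hsup x' i).trans hJsmall
  have ha' : ∀ μ x' i, ∑ j, |gacoefM e η' A' μ x' i j| ≤ r₁ := fun μ x' i =>
    ((rowSum_gacoefM_le e hr2 hη' (hη'η.trans hη1) hsup μ x' i).trans hunit).trans hone
  have hc : ∀ x i, ∑ j, |gcoefM e η (gavgM 𝔄 J π A') x i j| ≤ r₁ := fun x i =>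
    (rowSum_gcoefM_le e hr2 hη0 hη1 hAbar x i).trans hJsmall
  have ha : ∀ μ x i, ∑ j, |gacoefM e η (gavgM 𝔄 J π A') μ x i j| ≤ r₁ := fun μ x i =>
    ((rowSum_gacoefM_le e hr2 hη0 hη1 hAbar μ x i).trans hunit).trans hone
  -- row fits, dominated by `r₁·θ`
  have hunitθ : basisConst e * (8 * Real.exp 1 * (r * θ)) ≤ 8 * Real.exp 1 * basisConst e * r * θ := le_of_eq (by ring)
  have honeθ : 8 * Real.exp 1 * basisConst e * r * θ ≤ r₁ * θ := mul_le_mul_of_nonneg_right hone hθ0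
  have hfc : ∀ x' i, ∑ j, |gcoefM e η' A' x' i j - gcoefM e η (gavgM 𝔄 J π A') (π x') i j| ≤ r₁ * θ := fun x' i => by
    refine (rowFit_gcoefM e π hr0 hr2 hη' hη'η hη1 hηθ hsup hAbar hfitA x' i).trans ?_
    have h6 : basisConst e * (6 * Real.exp 1 * (r * θ)) ≤ 8 * Real.exp 1 * basisConst e * r * θ := by
      nlinarith [mul_nonneg (mul_nonneg hκ he) (mul_nonneg hr0 hθ0)]
    calc Fintype.card J * (basisConst e * (6 * Real.exp 1 * (r * θ))) ≤ (1 + Fintype.card J) * (8 * Real.exp 1 * basisConst e * r * θ) :=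
          mul_le_mul hJ1 h6 (by positivity) hJ0
      _ = r₁ * θ := by rw [hr₁_def]; ring
  have hfa : ∀ μ x' i, ∑ j, |gacoefM e η' A' μ x' i j - gacoefM e η (gavgM 𝔄 J π A') μ (π x') i j| ≤ r₁ * θ := fun μ x' i =>
    ((rowFit_gacoefM e π hr0 hr2 hη' hη'η hη1 hηθ hsup hAbar hfitA μ x' i).trans hunitθ).trans honeθ
  have hr₁a : r₁ ≤ 8 * Real.exp 1 * (1 + Fintype.card J) * basisConst e * c35 * a₀ := by
    rw [hr₁_def]
    calc 8 * Real.exp 1 * (1 + Fintype.card J) * basisConst e * r ≤ 8 * Real.exp 1 * (1 + Fintype.card J) * basisConst e * (c35 * a₀) :=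
          mul_le_mul_of_nonneg_left hra (by positivity)
      _ = _ := by ring
  refine ⟨hr₁0, hr₁a, hasMaj_unstackM blk hr₁0 hc ha, hasMaj_unstackM (blk ∘ π) hr₁0 hc' ha', ?_⟩
  exact hasMaj_idef_unstackM blk π (mul_nonneg hr₁0 hθ0) hfc hfa

end Letters

end Summit.QuantumFields.YangMills.BalabanUVNodes.N15.BackgroundLayer
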